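import Summits.CriticalPhenomena.PercolationContinuityZ3.Theorems.PercNearOneGluingNoHeavyLowerTailSahiC3CubeEvents

/-!
# `NoHeavyLowerTail` (crux stmt-CriticalPhenomena-4575), Sahi programme P1: Sahi's `C₃` holds on the cubes `{0,1}^m`,
# `m ≤ 3`, for every product measure — KERNEL-checked (`decide`)

Support file (Sahi cell, seat `prim-sahi-p1`; `--supports stmt-CriticalPhenomena-4575`).

**Theorems `sahiC3_cube_two`, `sahiC3_cube_three`, `sahiC3_cube_le_three`.**  For `m ≤ 3`, every `p : Fin m → [0,1]` and all
increasing events `A, B, C ⊆ Set (Fin m)` (= up-sets of the Boolean lattice `{0,1}^m`):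

  `0 ≤ E₃(A,B,C) = 2μ(A∩B∩C) + μ(A)μ(B)μ(C) − μ(A)μ(B∩C) − μ(B)μ(A∩C) − μ(C)μ(A∩B)`,  `μ = prodBernoulli p`

(`Literature.Probability.LatticeModels.sahiE3`; Sahi 2008 Conj. 5 / Kahn 2022 Conj. 5 restricted to `m ≤ 3`, arbitrary —
not necessarily equal — coordinate probabilities).  Proof: the cube check `checkCube m σ` of `…SahiC3CubeCertCheck` / `…SahiC3CubeEvents` returns
`true` for `(m, σ) = (0,4), (1,7), (2,10), (3,13)`, evaluated by the KERNEL (`decide +kernel`; `m = 3`: 20 increasing bitmasks,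
1 540 sorted triples, 64 base-`2^13` digits each, ≈ 10 s), i.e. every tensor-Bernstein coefficient of every `E₃(A,B,C)` is a
nonnegative integer; `sahiE3_nonneg_of_checkCube` does the rest.  `m = 4` (168 bitmasks, 804 440 sorted triples) is evaluated
by compiled code in `…SahiC3CubeFour`.
-/

namespace Summit.CriticalPhenomena.PercolationContinuityZ3.Theorems.SahiC3Cube

open Literature.Probability.Percolation Literature.Probability.LatticeModels

/-- The cube check passes in dimension `0` (kernel evaluation). [this work] -/
theorem checkCube_zero : checkCube 0 4 = true := by decide +kernel

/-- The cube check passes in dimension `1` (kernel evaluation). [this work] -/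
theorem checkCube_one : checkCube 1 7 = true := by decide +kernel

/-- The cube check passes in dimension `2`: all `6` increasing bitmasks, base `2^10` (kernel evaluation). [this work] -/
theorem checkCube_two : checkCube 2 10 = true := by decide +kernel

/-- The cube check passes in dimension `3`: all `20` increasing bitmasks, `1 540` sorted triples, base `2^13` (kernel
evaluation, ≈ 10 s). [this work] -/
theorem checkCube_three : checkCube 3 13 = true := by decide +kernel

/-- **Sahi's `C₃` on `{0,1}²` for every product measure.** [this work] -/
theorem sahiC3_cube_two (p : Fin 2 → unitInterval) {A B C : Set (Set (Fin 2))} (hA : IsUpperSet A) (hB : IsUpperSet B)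
    (hC : IsUpperSet C) : 0 ≤ sahiE3 (prodBernoulli p) A B C :=
  sahiE3_nonneg_of_checkCube checkCube_two p hA hB hC

/-- **Sahi's `C₃` on `{0,1}³` for every product measure.** [this work] -/
theorem sahiC3_cube_three (p : Fin 3 → unitInterval) {A B C : Set (Set (Fin 3))} (hA : IsUpperSet A) (hB : IsUpperSet B)
    (hC : IsUpperSet C) : 0 ≤ sahiE3 (prodBernoulli p) A B C :=
  sahiE3_nonneg_of_checkCube checkCube_three p hA hB hC

/-- **Sahi's `C₃` on `{0,1}^m`, `m ≤ 3`, for every product measure.** [this work] -/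
theorem sahiC3_cube_le_three {m : ℕ} (hm : m ≤ 3) (p : Fin m → unitInterval) {A B C : Set (Set (Fin m))}
    (hA : IsUpperSet A) (hB : IsUpperSet B) (hC : IsUpperSet C) : 0 ≤ sahiE3 (prodBernoulli p) A B C := by
  interval_cases m
  · exact sahiE3_nonneg_of_checkCube checkCube_zero p hA hB hC
  · exact sahiE3_nonneg_of_checkCube checkCube_one p hA hB hC
  · exact sahiC3_cube_two p hA hB hC
  · exact sahiC3_cube_three p hA hB hC

end Summit.CriticalPhenomena.PercolationContinuityZ3.Theorems.SahiC3Cube
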